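import Summits.KontsevichZagierPeriods.KontsevichZagierPeriods.Theorems.SoloInformedAlgProducts
import Summits.KontsevichZagierPeriods.KontsevichZagierPeriods.Theorems.SoloInformedAlgGrid
import Mathlib.Topology.MetricSpace.Pseudo.Lemmas
import HarnessLib

/-!
# The DEN-calculus over `K`: RULE LOCAL-GLOBAL (Lebesgue number)

Solo programme `solo-KontsevichZagierPeriods-informed`, session s107: the DEN-calculus of the
cube crux over a coefficient field `K` of real algebraic numbers, step (x-c) of the general
two-dimensional algorithm — presentability of a denominator is a LOCAL property on the closed
cube.

* `SoloInformedLocallyPresentableDenK Q p` — `Q` is **locally presentable at `p`**: for some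
  `ε > 0`, every grid cell `(c + [0,1]ⁿ)/N` contained in the ball `B(p, ε)` (sup metric) has a
  presentable cell polynomial `Q((c + x)/N)` (`soloInformedGridSubstK`);
* **RULE LOCAL-GLOBAL** `soloInformed_presentableDenK_of_locally` — a denominator with no zero on
  the open cube that is locally presentable at every point of the closed cube is a presentable
  denominator: a Lebesgue number `δ` of the cover `{B(p, ε_p)}` of the compact cube
  (`lebesgue_number_lemma_of_metric`) and a mesh `1/N < δ` make every cell of the `Nⁿ`-grid lie in
  some `B(p, ε_p)`, and RULE GRID (`soloInformed_presentableDenK_of_grid`) assembles the cells;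
* **case L0** `soloInformed_locallyPresentableDenK_of_ne_zero` — `Q` is locally presentable at
  every point where it does not vanish (continuity, ND-UNIT / RULE UNIT-DEN
  `soloInformed_presentableDenK_of_forall_ne_zero`);
* `soloInformed_presentableDenK_of_locally_at_zeros` — hence THE GENERAL ALGORITHM REDUCES TO THE
  ZEROS OF `Q` ON THE BOUNDARY of the cube: a denominator with no zero on the open cube is
  presentable as soon as it is locally presentable at each of its zeros on the closed cube.

References: M. Kontsevich, D. Zagier, *Periods* (2001), §1.2; J. Kollár, *Lectures on Resolution
of Singularities* (2007), §1.8 (local-to-global organisation of embedded resolution of curves).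
-/

noncomputable section

open scoped BigOperators
open MeasureTheory Set
open Literature.NumberTheory.Transcendental Literature.NumberTheory.Transcendental.KZ

namespace Summit.KontsevichZagierPeriods.KontsevichZagierPeriods.Theorems

variable {n : ℕ} {K : Type*} [Field K] [Algebra K ℝ]

/-! ### Local presentability -/

/-- `Q ∈ K[x₁, …, xₙ]` is **locally presentable at `p`**: for some `ε > 0`, every grid cell
`(c + [0,1]ⁿ)/N` (`N ≥ 1`, `c ∈ {0, …, N−1}ⁿ`) contained in the sup-metric ball `B(p, ε)` has a
presentable cell polynomial `Q((c + x)/N)`. [this work] -/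
def SoloInformedLocallyPresentableDenK (Q : MvPolynomial (Fin n) K) (p : Fin n → ℝ) : Prop :=
  ∃ ε > (0 : ℝ), ∀ (N : ℕ) (c : Fin n → ℕ), 0 < N → (∀ j, c j < N) →
    (∀ x ∈ soloInformedCube n, (fun j => ((c j : ℝ) + x j) / N) ∈ Metric.ball p ε) →
    SoloInformedPresentableDenK (soloInformedGridSubstK Finset.univ N c Q)

omit [Algebra K ℝ] in
/-- The corner `c/N` of a grid cell lies in the closed cube. [this work] -/
theorem soloInformed_gridCorner_mem_cube {N : ℕ} {c : Fin n → ℕ} (hc : ∀ j, c j < N) :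
    (fun j => (c j : ℝ) / N) ∈ soloInformedCube n := by
  intro j
  have hN : (0 : ℝ) < N := by exact_mod_cast lt_of_le_of_lt (Nat.zero_le _) (hc j)
  refine ⟨div_nonneg (Nat.cast_nonneg _) hN.le, ?_⟩
  rw [div_le_one hN]
  exact_mod_cast (hc j).le

omit [Algebra K ℝ] in
/-- A grid cell of mesh `1/N < δ` lies in the `δ`-ball about its corner (sup metric). [this work] -/
theorem soloInformed_gridPoint_mem_ball {N : ℕ} (hN : 0 < N) {δ : ℝ} (hδ : (1 : ℝ) / N < δ)
    (c : Fin n → ℕ) {x : Fin n → ℝ} (hx : x ∈ soloInformedCube n) :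
    (fun j => ((c j : ℝ) + x j) / N) ∈ Metric.ball (fun j => (c j : ℝ) / N) δ := by
  have hN' : (0 : ℝ) < N := by exact_mod_cast hN
  have hδ0 : 0 < δ := lt_trans (div_pos one_pos hN') hδ
  rw [Metric.mem_ball, dist_pi_lt_iff hδ0]
  intro j
  rw [Real.dist_eq, ← sub_div, add_sub_cancel_left, abs_div, abs_of_pos hN',
    abs_of_nonneg (hx j).1]
  exact lt_of_le_of_lt (div_le_div_of_nonneg_right (hx j).2 hN'.le) hδ

/-! ### RULE LOCAL-GLOBAL -/

/-- **RULE LOCAL-GLOBAL.**  Over a field `K` of real algebraic numbers: a denominator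
`Q ∈ K[x₁, …, xₙ]` with no zero on the open cube which is locally presentable at every point of
the closed cube is a presentable denominator. [this work] -/
theorem soloInformed_presentableDenK_of_locally
    (hK : ∀ c : K, IsAlgebraic ℚ (algebraMap K ℝ c)) {Q : MvPolynomial (Fin n) K}
    (hQ : ∀ x ∈ soloInformedOpenCube n, (MvPolynomial.aeval x Q : ℝ) ≠ 0)
    (hloc : ∀ p ∈ soloInformedCube n, SoloInformedLocallyPresentableDenK Q p) :
    SoloInformedPresentableDenK Q := by
  classical
  choose! ε hε hH using hloc
  -- a Lebesgue number of the cover of the compact cube by the balls `B(p, ε_p)`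
  obtain ⟨δ, hδ, hcover⟩ := lebesgue_number_lemma_of_metric (ι := soloInformedCube n)
    (c := fun p => Metric.ball (p : Fin n → ℝ) (ε p)) (isCompact_soloInformedCube n)
    (fun _ => Metric.isOpen_ball)
    (fun x hx => Set.mem_iUnion.2 ⟨⟨x, hx⟩, Metric.mem_ball_self (hε x hx)⟩)
  -- a mesh `1/N < δ`
  obtain ⟨N₀, hN₀⟩ := exists_nat_one_div_lt hδ
  have hN : 0 < N₀ + 1 := Nat.succ_pos N₀
  have hmesh : (1 : ℝ) / ((N₀ + 1 : ℕ) : ℝ) < δ := by push_cast; exact hN₀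
  refine soloInformed_presentableDenK_of_grid hK hN hQ fun c hc => ?_
  -- the cell with corner `c/N` lies in `B(c/N, δ) ⊆ B(p, ε_p)` for some `p`
  obtain ⟨⟨p, hp⟩, hball⟩ := hcover _ (soloInformed_gridCorner_mem_cube hc)
  exact hH p hp (N₀ + 1) c hN hc fun x hx =>
    hball (soloInformed_gridPoint_mem_ball hN hmesh c hx)

/-! ### Case L0: points where `Q` does not vanish -/

/-- **Case L0.**  Over a field `K` of real algebraic numbers, `Q` is locally presentable at every
point where it does not vanish: nearby cells have zero-free cell polynomials on the closed cube
(RULE UNIT-DEN). [this work] -/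
theorem soloInformed_locallyPresentableDenK_of_ne_zero
    (hK : ∀ c : K, IsAlgebraic ℚ (algebraMap K ℝ c)) (Q : MvPolynomial (Fin n) K)
    {p : Fin n → ℝ} (hp : (MvPolynomial.aeval p Q : ℝ) ≠ 0) :
    SoloInformedLocallyPresentableDenK Q p := by
  have hU : IsOpen {x : Fin n → ℝ | (MvPolynomial.aeval x Q : ℝ) ≠ 0} :=
    isOpen_ne_fun (soloInformed_continuous_aevalK Q) continuous_const
  obtain ⟨ε, hε, hball⟩ := Metric.isOpen_iff.1 hU p hp
  refine ⟨ε, hε, fun N c _ _ hcell => soloInformed_presentableDenK_of_forall_ne_zero hK ?_⟩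
  intro y hy
  rw [soloInformed_aeval_gridSubstK, soloInformed_gridMoveR_univ]
  exact hball (hcell y hy)

/-- **THE ALGORITHM REDUCES TO THE ZEROS OF `Q`.**  Over a field `K` of real algebraic numbers, a
denominator with no zero on the open cube which is locally presentable at each of its zeros on
the closed cube (necessarily boundary points) is a presentable denominator. [this work] -/
theorem soloInformed_presentableDenK_of_locally_at_zeros
    (hK : ∀ c : K, IsAlgebraic ℚ (algebraMap K ℝ c)) {Q : MvPolynomial (Fin n) K}
    (hQ : ∀ x ∈ soloInformedOpenCube n, (MvPolynomial.aeval x Q : ℝ) ≠ 0)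
    (hzero : ∀ p ∈ soloInformedCube n, (MvPolynomial.aeval p Q : ℝ) = 0 →
      SoloInformedLocallyPresentableDenK Q p) :
    SoloInformedPresentableDenK Q :=
  soloInformed_presentableDenK_of_locally hK hQ fun p hp => by
    by_cases h : (MvPolynomial.aeval p Q : ℝ) = 0
    · exact hzero p hp h
    · exact soloInformed_locallyPresentableDenK_of_ne_zero hK Q h

/-- Shrinking `ε` preserves local presentability: the defining property is monotone in the ball.
[this work] -/
theorem soloInformed_locallyPresentableDenK_of_ball
    {Q : MvPolynomial (Fin n) K} {p : Fin n → ℝ} {ε : ℝ} (hε : 0 < ε)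
    (h : ∀ (N : ℕ) (c : Fin n → ℕ), 0 < N → (∀ j, c j < N) →
      (∀ x ∈ soloInformedCube n, (fun j => ((c j : ℝ) + x j) / N) ∈ Metric.ball p ε) →
      SoloInformedPresentableDenK (soloInformedGridSubstK Finset.univ N c Q)) :
    SoloInformedLocallyPresentableDenK Q p :=
  ⟨ε, hε, h⟩

end Summit.KontsevichZagierPeriods.KontsevichZagierPeriods.Theorems
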